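import Summits.ValiantsHypothesis.ValiantsHypothesis.Theorems.NewtonUnitEquationsTwoProductsConfinedTameLawLift
import HarnessLib

/-!
# R10 (`positive-circuit-chart`) — ENGINE F4b: the MASS-REGROUPED SLICE FUNCTION and its finite shift rank
For a finite set `Φ` of «relation patterns» (letter vectors) with masses in `[B₀, B₀ + Δ]` and tails `c d : Fin m → σ → ℂ`, the slice
function of a free exponent `ν : σ → ℕ` is
`Fsl Φ B₀ Δ c d ν = Σ_{b ∈ Φ} (-1)^{|b|} · asc(|ν| + B₀, |b| − B₀) / b! · Σ_j (c_j^ν c_j^b − d_j^ν d_j^b)`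
(`asc` = ascending factorial).  Main result: the SHIFT DECOMPOSITION `Fsl (β + w) = Σ_{t} col β t · ch t w` over the index type
`Fin m × Bool × Fin (Δ+1)` — shift rank `2m(Δ+1)`, independent of `|Φ|`, of the coincidence rank and of the number of relation letters
(the point of the card: slicing ALL relation coordinates at once).  Tool: the expansion `asc(a + y, q) = Σ_i E a q i · y^i`.
R275 P3 scope: tool for the proper positive sub-case rung `ConfinedTameLaw`; nothing here closes 5906; VP ≠ VNP is NOT proved.
-/

noncomputable section
set_option linter.dupNamespace false
set_option linter.unusedSectionVars false

namespace Summit.ValiantsHypothesis.ValiantsHypothesis.Theorems.NewtonUnitEquations.TwoProducts.PermutationType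
namespace R10
open scoped BigOperators
open MvPolynomial

/-! ### The ascending-factorial expansion `asc(a + y, q) = Σ_i E a q i · y^i` -/

/-- Coefficients of `(a + y).ascFactorial q` as a polynomial in `y`. [folklore] -/
def E (a : ℕ) : ℕ → ℕ → ℕ
  | 0, i => if i = 0 then 1 else 0
  | q + 1, i => E a q i * (a + q) + (if i = 0 then 0 else E a q (i - 1))

/-- The coefficients vanish above the degree. [folklore] -/
theorem E_eq_zero_of_lt (a : ℕ) : ∀ q i, q < i → E a q i = 0
  | 0, i, h => by simp [E]; omega
  | q + 1, i, h => by
    simp only [E]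
    rw [E_eq_zero_of_lt a q i (by omega), zero_mul, zero_add]
    by_cases hi : i = 0
    · simp [hi]
    · rw [if_neg hi, E_eq_zero_of_lt a q (i - 1) (by omega)]

/-- **The expansion** `(a + y).ascFactorial q = Σ_{i ≤ q} E a q i · y^i`. [folklore] -/
theorem ascFactorial_add_eq (a y : ℕ) : ∀ q, (a + y).ascFactorial q = ∑ i ∈ Finset.range (q + 1), E a q i * y ^ i
  | 0 => by simp [E, Nat.ascFactorial_zero]
  | q + 1 => by
    rw [Nat.ascFactorial_succ, ascFactorial_add_eq a y q]
    -- (a + y + q) * Σ_i E i y^i = Σ_i (E i (a+q)) y^i + Σ_i E (i-1) y^i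
    have h1 : (a + y + q) * ∑ i ∈ Finset.range (q + 1), E a q i * y ^ i =
        (∑ i ∈ Finset.range (q + 1), E a q i * (a + q) * y ^ i) + ∑ i ∈ Finset.range (q + 1), E a q i * y ^ (i + 1) := by
      rw [Finset.mul_sum, ← Finset.sum_add_distrib]
      refine Finset.sum_congr rfl fun i _ => ?_
      ring
    rw [h1]
    symm
    rw [Finset.sum_range_succ' (fun i => E a (q + 1) i * y ^ i)]
    simp only [E, if_true, add_zero]
    have h2 : ∀ i, (if i + 1 = 0 then 0 else E a q (i + 1 - 1)) = E a q i := fun i => by simp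
    simp only [h2, add_mul, Finset.sum_add_distrib]
    have h3 : ∑ i ∈ Finset.range (q + 1), E a q (i + 1) * (a + q) * y ^ (i + 1) + E a q 0 * (a + q) * y ^ 0 =
        ∑ i ∈ Finset.range (q + 1), E a q i * (a + q) * y ^ i := by
      rw [Finset.sum_range_succ' (fun i => E a q i * (a + q) * y ^ i)]
      congr 1
      rw [Finset.sum_range_succ, E_eq_zero_of_lt a q (q + 1) (by omega)]; simp
    rw [pow_zero, mul_one]
    calc ∑ i ∈ Finset.range (q + 1), E a q (i + 1) * (a + q) * y ^ (i + 1) +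
          ∑ i ∈ Finset.range (q + 1), E a q i * y ^ (i + 1) + E a q 0 * (a + q)
        = (∑ i ∈ Finset.range (q + 1), E a q (i + 1) * (a + q) * y ^ (i + 1) + E a q 0 * (a + q) * y ^ 0) +
          ∑ i ∈ Finset.range (q + 1), E a q i * y ^ (i + 1) := by rw [pow_zero, mul_one]; ring
      _ = _ := by rw [h3]

/-! ### The slice function -/

variable {σ : Type*} [Fintype σ] [DecidableEq σ]
variable {m : ℕ}

/-- Monomial value of a plain exponent function. [folklore] -/
def momF (a : σ → ℂ) (ν : σ → ℕ) : ℂ := ∏ i, a i ^ ν i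

/-- Mass of a plain exponent function. [folklore] -/
def mass (ν : σ → ℕ) : ℕ := ∑ i, ν i

/-- `momF` is multiplicative. [folklore] -/
theorem momF_add (a : σ → ℂ) (β w : σ → ℕ) : momF a (β + w) = momF a β * momF a w := by
  unfold momF; rw [← Finset.prod_mul_distrib]; exact Finset.prod_congr rfl fun i _ => by rw [Pi.add_apply, pow_add]

/-- `mass` is additive. [folklore] -/
theorem mass_add (β w : σ → ℕ) : mass (β + w) = mass β + mass w := by
  unfold mass; rw [← Finset.sum_add_distrib]; rfl

/-- The factorial product `b! = ∏ b_i!` of a pattern. [folklore] -/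
def bfact (b : σ →₀ ℕ) : ℕ := ∏ i, Nat.factorial (b i)

/-- The pattern weight `(-1)^{|b|} · E-free part`: `wP B₀ ν b = (-1)^{|b|} asc(|ν|+B₀, |b|−B₀) / b!`. [folklore] -/
def wP (B₀ : ℕ) (ν : σ → ℕ) (b : σ →₀ ℕ) : ℂ :=
  (-1 : ℂ) ^ deg b * (((mass ν + B₀).ascFactorial (deg b - B₀) : ℕ) : ℂ) / ((bfact b : ℕ) : ℂ)

/-- **The mass-regrouped slice function** of a pattern class `Φ` (base mass `B₀`). [folklore] -/
def Fsl (Φ : Finset (σ →₀ ℕ)) (B₀ : ℕ) (c d : Fin m → σ → ℂ) (ν : σ → ℕ) : ℂ :=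
  ∑ b ∈ Φ, wP B₀ ν b * ∑ j, (momF (c j) ν * mom (c j) b - momF (d j) ν * mom (d j) b)

/-- The shift index type: `(chain index, side, power of the mass)`. [folklore] -/
abbrev SIdx (m Δ : ℕ) := Fin m × Bool × Fin (Δ + 1)

/-- Its cardinality `2m(Δ+1)`. [folklore] -/
theorem card_SIdx (m Δ : ℕ) : Fintype.card (SIdx m Δ) = 2 * m * (Δ + 1) := by
  simp only [SIdx, Fintype.card_prod, Fintype.card_fin, Fintype.card_bool]; ring

/-- Column functions of the shift decomposition (depend on the shift `β`). [folklore] -/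
def col (Δ : ℕ) (c d : Fin m → σ → ℂ) (β : σ → ℕ) : SIdx m Δ → ℂ
  | (j, true, i) => momF (c j) β * ((mass β : ℂ)) ^ (i : ℕ)
  | (j, false, i) => momF (d j) β * ((mass β : ℂ)) ^ (i : ℕ)

/-- Character functions of the shift decomposition (depend on the argument `w`). [folklore] -/
def ch (Φ : Finset (σ →₀ ℕ)) (B₀ Δ : ℕ) (c d : Fin m → σ → ℂ) : SIdx m Δ → (σ → ℕ) → ℂ
  | (j, true, i) => fun w => momF (c j) w *
      ∑ b ∈ Φ, (-1 : ℂ) ^ deg b * ((E (mass w + B₀) (deg b - B₀) i : ℕ) : ℂ) / ((bfact b : ℕ) : ℂ) * mom (c j) b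
  | (j, false, i) => fun w => -(momF (d j) w *
      ∑ b ∈ Φ, (-1 : ℂ) ^ deg b * ((E (mass w + B₀) (deg b - B₀) i : ℕ) : ℂ) / ((bfact b : ℕ) : ℂ) * mom (d j) b)

/-- The pattern weight at a shifted argument, expanded in powers of the shift mass. [folklore] -/
theorem wP_add (B₀ Δ : ℕ) (β w : σ → ℕ) (b : σ →₀ ℕ) (hb : deg b - B₀ ≤ Δ) :
    wP B₀ (β + w) b = ∑ i : Fin (Δ + 1),
      (-1 : ℂ) ^ deg b * ((E (mass w + B₀) (deg b - B₀) i : ℕ) : ℂ) / ((bfact b : ℕ) : ℂ) * ((mass β : ℂ)) ^ (i : ℕ) := by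
  unfold wP
  have hq : deg b - B₀ + 1 ≤ Δ + 1 := by omega
  rw [mass_add, show mass β + mass w + B₀ = (mass w + B₀) + mass β by ring, ascFactorial_add_eq]
  push_cast
  rw [Finset.mul_sum, Finset.sum_div]
  rw [Fin.sum_univ_eq_sum_range (fun i => (-1 : ℂ) ^ deg b * ((E (mass w + B₀) (deg b - B₀) i : ℕ) : ℂ) /
    ((bfact b : ℕ) : ℂ) * ((mass β : ℂ)) ^ i) (Δ + 1)]
  rw [← Finset.sum_range_add_sum_Ico _ hq]
  have hz : ∑ i ∈ Finset.Ico (deg b - B₀ + 1) (Δ + 1), (-1 : ℂ) ^ deg b * ((E (mass w + B₀) (deg b - B₀) i : ℕ) : ℂ) /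
      ((bfact b : ℕ) : ℂ) * ((mass β : ℂ)) ^ i = 0 :=
    Finset.sum_eq_zero fun i hi => by
      rw [E_eq_zero_of_lt _ _ i (by have := (Finset.mem_Ico.mp hi).1; omega)]; simp
  rw [hz, add_zero]
  refine Finset.sum_congr rfl fun i _ => ?_
  ring

/-- **Finite shift rank of the slice function**: `Fsl (β + w) = Σ_t col β t · ch t w` over `Fin m × Bool × Fin (Δ+1)`, whenever all
pattern masses exceed `B₀` by at most `Δ`. [folklore] -/
theorem Fsl_shift (Φ : Finset (σ →₀ ℕ)) (B₀ Δ : ℕ) (c d : Fin m → σ → ℂ) (hΦ : ∀ b ∈ Φ, deg b - B₀ ≤ Δ) (β w : σ → ℕ) :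
    Fsl Φ B₀ c d (β + w) = ∑ t : SIdx m Δ, col Δ c d β t * ch Φ B₀ Δ c d t w := by
  classical
  -- canonical triple summand
  set A : (σ →₀ ℕ) → Fin (Δ + 1) → ℂ := fun b i =>
    (-1 : ℂ) ^ deg b * ((E (mass w + B₀) (deg b - B₀) i : ℕ) : ℂ) / ((bfact b : ℕ) : ℂ) with hA
  set T : (σ →₀ ℕ) → Fin m → Fin (Δ + 1) → ℂ := fun b j i =>
    A b i * ((mass β : ℂ)) ^ (i : ℕ) *
      (momF (c j) β * momF (c j) w * mom (c j) b - momF (d j) β * momF (d j) w * mom (d j) b) with hT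
  have lhs : Fsl Φ B₀ c d (β + w) = ∑ b ∈ Φ, ∑ j, ∑ i : Fin (Δ + 1), T b j i := by
    unfold Fsl
    refine Finset.sum_congr rfl fun b hb => ?_
    rw [wP_add B₀ Δ β w b (hΦ b hb), Finset.sum_mul, Finset.sum_comm]
    refine Finset.sum_congr rfl fun i _ => ?_
    rw [Finset.mul_sum]
    refine Finset.sum_congr rfl fun j _ => ?_
    simp only [hT, hA, momF_add]
  have rhs : ∑ t : SIdx m Δ, col Δ c d β t * ch Φ B₀ Δ c d t w = ∑ j, ∑ i : Fin (Δ + 1), ∑ b ∈ Φ, T b j i := by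
    rw [Fintype.sum_prod_type]
    refine Finset.sum_congr rfl fun j _ => ?_
    rw [Fintype.sum_prod_type, Fintype.sum_bool]
    simp only [col, ch]
    rw [← Finset.sum_add_distrib]
    refine Finset.sum_congr rfl fun i _ => ?_
    rw [mul_neg, Finset.mul_sum, Finset.mul_sum, Finset.mul_sum, Finset.mul_sum, ← sub_eq_add_neg, ← Finset.sum_sub_distrib]
    refine Finset.sum_congr rfl fun b _ => ?_
    simp only [hT, hA]
    ring
  rw [lhs, rhs, Finset.sum_comm]
  exact Finset.sum_congr rfl fun j _ => Finset.sum_comm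

end R10
end Summit.ValiantsHypothesis.ValiantsHypothesis.Theorems.NewtonUnitEquations.TwoProducts.PermutationType

end
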